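import Mathlib

/-!
# (W3) SHELL SUMMATION and (W3′) THE WEIGHTED SHELL BUDGET — plates of nsreg-p2 ROUND-47 v1.2 §5 «THE SHELL
SUMMATION — K″'s threshold is an artefact of (W2)» (`r47/Sketch47.lean` sha16 2caedb04fb0e9585, texts VERBATIM)

Width piece for crux `EulerZoomLiouville.PowerGaugeEulerLiouville` (stmt-NavierStokesRegularity-19832), by name under
LEAD 19832 (ns-typeII-p2 g14) and planner nsreg-p2 g37 (key 00:55:50Z: «ezl-w2 g5 — take (W3)+(W3′)»); seat
ns-ezl-w2 g5, `--supports stmt-NavierStokesRegularity-19832 --as helper`.  Consumer: ns-sfl-p1 g7's THEOREM K∞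
`FiniteTypeLiouville` / K^Σ `SummabilityLiouville` (K″'s tree proof up to `hwin`, then these two instead of (W2)).

* `shellSummation` = `NsregP2.R47.ShellSummation` (W3, EXACT, S): pure finite sums — if the weighted shell increments
  `Σ_{k<n} (q^{k+1}L₀)^{ρ−1}(F(q^{k+1}L₀) − F(qᵏL₀))` are bounded by `B` for all `n` and every window pays
  `F(qℓ) − F(ℓ) ≥ aℓ^{1−ρ}` (`ℓ ≥ L₀`), then `a ≤ 0` (each term is `≥ a·q^{ρ−1}`; Archimedes).
* `weightedShellBudget` = `NsregP2.R47.WeightedShellBudget` (W3′, EXACT, S+): layer cake — from the GLOBAL weighted bound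
  `∫⁻ ‖DV‖ₑ²‖y‖^{ρ−1} ≤ B` of a `C¹` field, for `q > 1`, `L₀ > 0` and every `n`:
  `Σ_{k<n} (q^{k+1}L₀)^{ρ−1}(∫_{B(0,q^{k+1}L₀)}‖DV‖² − ∫_{B(0,qᵏL₀)}‖DV‖²) ≤ B` (the shells
  `B(0,q^{k+1}L₀) ∖ B(0,qᵏL₀)` are disjoint and on the `k`-th one `‖y‖^{ρ−1} ≥ (q^{k+1}L₀)^{ρ−1}` since `ρ < 1`).

HONEST FRAMING: finite sums and measure theory on the MODEL lattice of crux E; proves nothing about the crux (19832 OPEN),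
about `Sig.stub_selfSimilarC2Needle`, about K∞/K^Σ themselves, or about Navier–Stokes regularity; no hard core is
touched. [folklore]
-/

noncomputable section

open Set Filter Topology Metric Function MeasureTheory
open scoped ENNReal NNReal

set_option linter.dupNamespace false

namespace Summit.NavierStokesRegularity.NavierStokesRegularity.Theorems.PowerGaugeEulerLiouville.Condenser

/-! ## (W3) Shell summation -/

/-- **(W3) SHELL SUMMATION**, working form.  With `q > 1`, `L₀ > 0` (the plate's binder `ρ < 1` is idle here): if
`Σ_{k<n} (q^{k+1}L₀)^{ρ−1}(F(q^{k+1}L₀) − F(qᵏL₀)) ≤ B` for all `n` and `aℓ^{1−ρ} ≤ F(qℓ) − F(ℓ)` for all `ℓ ≥ L₀`, then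
`a ≤ 0`.  Proof: at `ℓ = qᵏL₀` the `k`-th term is `≥ (q^{k+1}L₀)^{ρ−1}·a(qᵏL₀)^{1−ρ} = a·q^{ρ−1}`, so `n·a·q^{ρ−1} ≤ B` for
every `n`; Archimedes. [folklore] -/
theorem shellSummation_of {F : ℝ → ℝ} {ρ a q L₀ B : ℝ} (hq : 1 < q) (hL₀ : 0 < L₀)
    (hsum : ∀ n : ℕ, ∑ k ∈ Finset.range n,
        (q ^ (k + 1) * L₀) ^ (ρ - 1) * (F (q ^ (k + 1) * L₀) - F (q ^ k * L₀)) ≤ B)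
    (hwin : ∀ ℓ : ℝ, L₀ ≤ ℓ → a * ℓ ^ (1 - ρ) ≤ F (q * ℓ) - F ℓ) : a ≤ 0 := by
  by_contra ha
  push Not at ha
  have hq0 : 0 < q := zero_lt_one.trans hq
  have hq1 : 1 ≤ q := hq.le
  -- each term is at least `a · q^{ρ−1}`
  set c₀ : ℝ := a * q ^ (ρ - 1) with hc₀
  have hc₀pos : 0 < c₀ := mul_pos ha (Real.rpow_pos_of_pos hq0 _)
  have hterm : ∀ k : ℕ, c₀ ≤ (q ^ (k + 1) * L₀) ^ (ρ - 1) * (F (q ^ (k + 1) * L₀) - F (q ^ k * L₀)) := by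
    intro k
    have hx : 0 < q ^ k * L₀ := mul_pos (pow_pos hq0 k) hL₀
    have hxL : L₀ ≤ q ^ k * L₀ := le_mul_of_one_le_left hL₀.le (one_le_pow₀ hq1)
    have hw : 0 < (q ^ (k + 1) * L₀) ^ (ρ - 1) := Real.rpow_pos_of_pos (mul_pos (pow_pos hq0 _) hL₀) _
    have hF := hwin (q ^ k * L₀) hxL
    rw [show q * (q ^ k * L₀) = q ^ (k + 1) * L₀ by ring] at hF
    have key : (q ^ (k + 1) * L₀) ^ (ρ - 1) * (a * (q ^ k * L₀) ^ (1 - ρ)) = c₀ := by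
      rw [show q ^ (k + 1) * L₀ = q * (q ^ k * L₀) by ring, Real.mul_rpow hq0.le hx.le, hc₀]
      have h1 : (q ^ k * L₀) ^ (ρ - 1) * (q ^ k * L₀) ^ (1 - ρ) = 1 := by
        rw [← Real.rpow_add hx, show ρ - 1 + (1 - ρ) = 0 by ring, Real.rpow_zero]
      calc q ^ (ρ - 1) * (q ^ k * L₀) ^ (ρ - 1) * (a * (q ^ k * L₀) ^ (1 - ρ))
          = a * q ^ (ρ - 1) * ((q ^ k * L₀) ^ (ρ - 1) * (q ^ k * L₀) ^ (1 - ρ)) := by ring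
        _ = a * q ^ (ρ - 1) := by rw [h1, mul_one]
    rw [← key]
    exact mul_le_mul_of_nonneg_left hF hw.le
  -- sum and Archimedes
  have hn : ∀ n : ℕ, (n : ℝ) * c₀ ≤ B := fun n => by
    calc (n : ℝ) * c₀ = ∑ _k ∈ Finset.range n, c₀ := by rw [Finset.sum_const, Finset.card_range, nsmul_eq_mul]
      _ ≤ ∑ k ∈ Finset.range n, (q ^ (k + 1) * L₀) ^ (ρ - 1) * (F (q ^ (k + 1) * L₀) - F (q ^ k * L₀)) :=
          Finset.sum_le_sum fun k _ => hterm k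
      _ ≤ B := hsum n
  obtain ⟨n, hnB⟩ := exists_nat_gt (B / c₀)
  have h := hn n
  rw [div_lt_iff₀ hc₀pos] at hnB
  linarith

/-- **(W3) `NsregP2.R47.ShellSummation`, binder-for-binder** (Sketch47 v1.2 of nsreg-p2 g37, §5): replaces (W2)
`telescopingBudget_of` in K″'s last step — the window payments contradict a bounded WEIGHTED shell sum for every
`a > 0`, i.e. for every finite type constant. [folklore] -/
theorem shellSummation :
    ∀ (F : ℝ → ℝ) (ρ a q L₀ B : ℝ), ρ < 1 → 1 < q → 0 < L₀ →
      (∀ n : ℕ, ∑ k ∈ Finset.range n,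
          (q ^ (k + 1) * L₀) ^ (ρ - 1) * (F (q ^ (k + 1) * L₀) - F (q ^ k * L₀)) ≤ B) →
      (∀ ℓ : ℝ, L₀ ≤ ℓ → a * ℓ ^ (1 - ρ) ≤ F (q * ℓ) - F ℓ) → a ≤ 0 :=
  fun _ _ _ _ _ _ _ hq hL₀ hsum hwin => shellSummation_of hq hL₀ hsum hwin

/-! ## (W3′) The weighted shell budget -/

/-- The geometric radii `qᵏL₀` are positive and non-decreasing in `k` (`q ≥ 1`, `L₀ > 0`). [folklore] -/
theorem geomRadius_pos_mono {q L₀ : ℝ} (hq : 1 ≤ q) (hL₀ : 0 < L₀) :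
    (∀ k : ℕ, 0 < q ^ k * L₀) ∧ ∀ {i j : ℕ}, i ≤ j → q ^ i * L₀ ≤ q ^ j * L₀ :=
  ⟨fun k => mul_pos (pow_pos (zero_lt_one.trans_le hq) k) hL₀,
    fun {_ _} hij => mul_le_mul_of_nonneg_right (pow_le_pow_right₀ hq hij) hL₀.le⟩

/-- **(W3′) THE WEIGHTED SHELL BUDGET**, working form.  For `V ∈ C¹(ℝ³;ℝ³)`, `ρ < 1`, `q > 1`, `L₀ > 0`, `B ≥ 0` with
`∫⁻ ‖DV(y)‖ₑ² ‖y‖^{ρ−1} dy ≤ B`: for every `n`,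
`Σ_{k<n} (q^{k+1}L₀)^{ρ−1}(∫_{B(0,q^{k+1}L₀)}‖DV‖² − ∫_{B(0,qᵏL₀)}‖DV‖²) ≤ B`.
Proof (layer cake): the `k`-th increment is the integral of `‖DV‖²` over the shell `B(0,q^{k+1}L₀) ∖ B(0,qᵏL₀)`, where
`‖y‖^{ρ−1} ≥ (q^{k+1}L₀)^{ρ−1}`; the shells are disjoint, so the weighted sum is at most `∫ ‖DV‖²‖y‖^{ρ−1} ≤ B`. [folklore] -/
theorem weightedShellBudget_of {V : EuclideanSpace ℝ (Fin 3) → EuclideanSpace ℝ (Fin 3)} {ρ B q L₀ : ℝ}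
    (hV : ContDiff ℝ 1 V) (hρ : ρ < 1) (hq : 1 < q) (hL₀ : 0 < L₀) (hB : 0 ≤ B)
    (hE : ∫⁻ y, ‖fderiv ℝ V y‖ₑ ^ 2 * ENNReal.ofReal (‖y‖ ^ (ρ - 1)) ≤ ENNReal.ofReal B) (n : ℕ) :
    ∑ k ∈ Finset.range n,
        (q ^ (k + 1) * L₀) ^ (ρ - 1) *
          ((∫ z in ball (0 : EuclideanSpace ℝ (Fin 3)) (q ^ (k + 1) * L₀), ‖fderiv ℝ V z‖ ^ 2) -
            ∫ z in ball (0 : EuclideanSpace ℝ (Fin 3)) (q ^ k * L₀), ‖fderiv ℝ V z‖ ^ 2) ≤ B := by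
  obtain ⟨hr0, hrmono⟩ := geomRadius_pos_mono hq.le hL₀
  -- the integrand and the weighted integrand
  set f : EuclideanSpace ℝ (Fin 3) → ℝ := fun z => ‖fderiv ℝ V z‖ ^ 2 with hf
  have hfc : Continuous f := ((hV.continuous_fderiv one_ne_zero).norm).pow 2
  have hf0 : ∀ z, 0 ≤ f z := fun z => sq_nonneg _
  set g : EuclideanSpace ℝ (Fin 3) → ℝ := fun z => f z * ‖z‖ ^ (ρ - 1) with hg
  have hg0 : ∀ z, 0 ≤ g z := fun z => mul_nonneg (hf0 z) (Real.rpow_nonneg (norm_nonneg _) _)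
  have hgm : Measurable g := hfc.measurable.mul (continuous_norm.measurable.pow_const _)
  -- the shells
  set S : ℕ → Set (EuclideanSpace ℝ (Fin 3)) := fun k =>
    ball (0 : EuclideanSpace ℝ (Fin 3)) (q ^ (k + 1) * L₀) \ ball 0 (q ^ k * L₀) with hS
  have hSm : ∀ k, MeasurableSet (S k) := fun k => measurableSet_ball.diff measurableSet_ball
  have hSmem : ∀ k, ∀ z ∈ S k, q ^ k * L₀ ≤ ‖z‖ ∧ ‖z‖ < q ^ (k + 1) * L₀ := by
    intro k z hz
    simp only [hS, Set.mem_sdiff, mem_ball, dist_zero_right, not_lt] at hz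
    exact ⟨hz.2, hz.1⟩
  have hfi : ∀ R : ℝ, IntegrableOn f (ball (0 : EuclideanSpace ℝ (Fin 3)) R) := fun R =>
    (hfc.continuousOn.integrableOn_compact (isCompact_closedBall 0 R)).mono_set ball_subset_closedBall
  -- the increment is the shell integral
  have hshell : ∀ k : ℕ, (∫ z in ball (0 : EuclideanSpace ℝ (Fin 3)) (q ^ (k + 1) * L₀), f z) -
      ∫ z in ball (0 : EuclideanSpace ℝ (Fin 3)) (q ^ k * L₀), f z = ∫ z in S k, f z := fun k => by
    rw [hS, setIntegral_sdiff measurableSet_ball (hfi _) (ball_subset_ball (hrmono (Nat.le_succ k)))]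
  -- the weighted integrand is integrable on each shell and dominates the weighted increment
  have hgi : ∀ k : ℕ, IntegrableOn g (S k) := by
    intro k
    have hK : IsCompact (closedBall (0 : EuclideanSpace ℝ (Fin 3)) (q ^ (k + 1) * L₀) ∩ {z | q ^ k * L₀ ≤ ‖z‖}) :=
      (isCompact_closedBall _ _).inter_right (isClosed_le continuous_const continuous_norm)
    have hcont : ContinuousOn g (closedBall (0 : EuclideanSpace ℝ (Fin 3)) (q ^ (k + 1) * L₀) ∩
        {z | q ^ k * L₀ ≤ ‖z‖}) := by
      refine hfc.continuousOn.mul (continuous_norm.continuousOn.rpow_const fun z hz => Or.inl ?_)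
      exact ne_of_gt ((hr0 k).trans_le hz.2)
    refine (hcont.integrableOn_compact hK).mono_set fun z hz => ?_
    obtain ⟨h1, h2⟩ := hSmem k z hz
    exact ⟨mem_closedBall_zero_iff.2 h2.le, h1⟩
  have hwk : ∀ k : ℕ, (q ^ (k + 1) * L₀) ^ (ρ - 1) * ∫ z in S k, f z ≤ ∫ z in S k, g z := by
    intro k
    rw [← integral_const_mul]
    refine setIntegral_mono_on (((hfi _).mono_set sdiff_subset).const_mul _) (hgi k) (hSm k) fun z hz => ?_
    obtain ⟨h1, h2⟩ := hSmem k z hz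
    have hzpos : 0 < ‖z‖ := (hr0 k).trans_le h1
    have hle : (q ^ (k + 1) * L₀) ^ (ρ - 1) ≤ ‖z‖ ^ (ρ - 1) :=
      Real.rpow_le_rpow_of_nonpos hzpos h2.le (by linarith)
    calc (q ^ (k + 1) * L₀) ^ (ρ - 1) * f z ≤ ‖z‖ ^ (ρ - 1) * f z := mul_le_mul_of_nonneg_right hle (hf0 z)
      _ = g z := by rw [hg, mul_comm]
  -- the shells are pairwise disjoint
  have hdisj : Set.Pairwise (↑(Finset.range n)) (Disjoint on S) := by
    intro i _ j _ hij
    rcases lt_or_gt_of_ne hij with h | h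
    · refine disjoint_left.2 fun z hzi hzj => ?_
      have h1 := (hSmem i z hzi).2
      have h2 := (hSmem j z hzj).1
      have h3 : q ^ (i + 1) * L₀ ≤ q ^ j * L₀ := hrmono (Nat.succ_le_of_lt h)
      linarith
    · refine disjoint_left.2 fun z hzi hzj => ?_
      have h1 := (hSmem j z hzj).2
      have h2 := (hSmem i z hzi).1
      have h3 : q ^ (j + 1) * L₀ ≤ q ^ i * L₀ := hrmono (Nat.succ_le_of_lt h)
      linarith
  have hU : ∫ z in ⋃ k ∈ Finset.range n, S k, g z = ∑ k ∈ Finset.range n, ∫ z in S k, g z :=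
    integral_biUnion_finset _ (fun k _ => hSm k) hdisj fun k _ => hgi k
  -- the union integral is bounded by the global weighted budget
  have hUB : ∫ z in ⋃ k ∈ Finset.range n, S k, g z ≤ B := by
    rw [integral_eq_lintegral_of_nonneg_ae (ae_of_all _ fun z => hg0 z) hgm.aestronglyMeasurable]
    refine ENNReal.toReal_le_of_le_ofReal hB ?_
    calc ∫⁻ z in ⋃ k ∈ Finset.range n, S k, ENNReal.ofReal (g z)
        ≤ ∫⁻ z, ENNReal.ofReal (g z) := setLIntegral_le_lintegral _ _
      _ = ∫⁻ y, ‖fderiv ℝ V y‖ₑ ^ 2 * ENNReal.ofReal (‖y‖ ^ (ρ - 1)) := by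
          refine lintegral_congr fun y => ?_
          rw [hg, hf, ENNReal.ofReal_mul (sq_nonneg _), ← ofReal_norm, ENNReal.ofReal_pow (norm_nonneg _)]
      _ ≤ ENNReal.ofReal B := hE
  -- assemble
  calc ∑ k ∈ Finset.range n, (q ^ (k + 1) * L₀) ^ (ρ - 1) *
        ((∫ z in ball (0 : EuclideanSpace ℝ (Fin 3)) (q ^ (k + 1) * L₀), f z) -
          ∫ z in ball (0 : EuclideanSpace ℝ (Fin 3)) (q ^ k * L₀), f z)
      = ∑ k ∈ Finset.range n, (q ^ (k + 1) * L₀) ^ (ρ - 1) * ∫ z in S k, f z :=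
        Finset.sum_congr rfl fun k _ => by rw [hshell k]
    _ ≤ ∑ k ∈ Finset.range n, ∫ z in S k, g z := Finset.sum_le_sum fun k _ => hwk k
    _ = ∫ z in ⋃ k ∈ Finset.range n, S k, g z := hU.symm
    _ ≤ B := hUB

/-- **(W3′) `NsregP2.R47.WeightedShellBudget`, binder-for-binder** (Sketch47 v1.2 of nsreg-p2 g37, §5; `E3` written out).
Input in the K∞ assembly: `NeedleThinCore.selfSimilar_needle_inputs` (2nd conjunct), `B = (1−ρ)c/(2+ρ)`. [folklore] -/
theorem weightedShellBudget :
    ∀ (V : EuclideanSpace ℝ (Fin 3) → EuclideanSpace ℝ (Fin 3)) (ρ B q L₀ : ℝ), ContDiff ℝ 1 V → ρ < 1 → 1 < q →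
      0 < L₀ → 0 ≤ B →
      ∫⁻ y, ‖fderiv ℝ V y‖ₑ ^ 2 * ENNReal.ofReal (‖y‖ ^ (ρ - 1)) ≤ ENNReal.ofReal B →
      ∀ n : ℕ, ∑ k ∈ Finset.range n,
          (q ^ (k + 1) * L₀) ^ (ρ - 1) *
            ((∫ z in ball (0 : EuclideanSpace ℝ (Fin 3)) (q ^ (k + 1) * L₀), ‖fderiv ℝ V z‖ ^ 2) -
              ∫ z in ball (0 : EuclideanSpace ℝ (Fin 3)) (q ^ k * L₀), ‖fderiv ℝ V z‖ ^ 2) ≤ B :=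
  fun _ _ _ _ _ hV hρ hq hL₀ hB hE n => weightedShellBudget_of hV hρ hq hL₀ hB hE n

end Summit.NavierStokesRegularity.NavierStokesRegularity.Theorems.PowerGaugeEulerLiouville.Condenser

end
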